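import Literature.Topology.FourManifolds.FoxMilnorChart
import Literature.Topology.FourManifolds.KnotReparametrisation
import HarnessLib

/-!
# Ambient isotopies adjusting a knot in the stereographic chart: affine maps, rotations of the parameter

Topic `Literature/Topology/FourManifolds`; preparatory step of the proof programme of the
Fox–Milnor fact `Literature.Topology.FourManifolds.Knot.exists_isConnectedSum_isConcordant`: the
end knots of a conical concordance are adjusted by ambient isotopies `G` of `𝕊³` which are then
spliced into the cones (`ConcordanceEndSplice.lean`); for this the isotopies themselves are
needed (not only the isotopic knots), together with the two facts the splice consumes: the
orbit of the knot stays off the south pole, and the chart formula of the end stage. Everything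
here is proved; no named fact is introduced.

* `Knot.exists_ambientIsotopy_chartAffine` — for an affine map `z ↦ q + L (z - p)` of `ℝ³` with
  `det L > 0` and a knot `K` off the south pole: an ambient isotopy `G` with
  `ψ (G₁ (K x)) = q + L (ψ (K x) - p)` and `G_t (K x) ≠ southPole` for all `t`
  (`AffineIsotopy.exists_ambientIsotopy_affine` transported along `ψ`, as in
  `FoxMilnorModel.exists_map_homothety`).
* `Knot.horizRot e₁ e₂` — the rotation of `ℝ³` about the vertical axis taking the horizontal unit
  vector `e₂` to `e₁` (explicit matrix `[[p, -q, 0], [q, p, 0], [0, 0, 1]]`,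
  `p = ⟪e₁, e₂⟫`, `q = e₁₀ e₂₁ - e₁₁ e₂₀`), with `det = 1` (`det_toMat_horizRot`) and
  `horizRot e₁ e₂ e₂ = e₁`.
* `Knot.exists_ambientIsotopy_rotateParam` — rotating the parameter: an ambient isotopy `G` with
  `G₁ (K (circlePoint θ)) = K (circlePoint (θ + c))` whose orbit of `K` stays in `range K`
  (the twist isotopy of the positive lift `θ ↦ θ + c`, `Knot.twistIsotopy`).

## References

* M. W. Hirsch, *Differential Topology*, GTM 33 (1976), Ch. 8 §1 (Thm. 1.3), §3 (proof of
  Thm. 3.1). [HirschDT1976]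

## Design notes

No named facts, no `sorry`; `𝔼 n`, `𝕊 n` are local notation as in `Knots.lean`.
-/

open scoped Manifold Topology ContDiff Real RealInnerProductSpace
open Function Set Metric Filter

noncomputable section

namespace Literature.Topology.FourManifolds

/-- Local notation: `𝔼 n` is the model Euclidean space `EuclideanSpace ℝ (Fin n)`. -/
local notation "𝔼 " n:arg => EuclideanSpace ℝ (Fin n)

/-- Local notation: `𝕊 n` is the unit sphere in `EuclideanSpace ℝ (Fin (n + 1))`. -/
local notation "𝕊 " n:arg => (Metric.sphere (0 : EuclideanSpace ℝ (Fin (n + 1))) 1)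

attribute [local instance] fact_finrank_euclideanSpace_succ

namespace Knot

open KnotsInBall AffineIsotopy

/-! ### Affine maps of the chart -/

/-- **An affine map of the chart with positive determinant is realised on a knot by an ambient
isotopy of `𝕊³`** whose orbit of the knot stays off the south pole. [folklore] -/
theorem exists_ambientIsotopy_chartAffine (K : Knot) (hK : ∀ x, K x ≠ southPole) (p q : 𝔼 3)
    (L : 𝔼 3 ≃L[ℝ] 𝔼 3) (hL : 0 < (toMat (L : 𝔼 3 →L[ℝ] 𝔼 3)).det) :
    ∃ G : AmbientIsotopy (𝓡 3) (𝕊 3), (∀ t x, G.toFun t (K x) ≠ southPole) ∧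
      ∀ x, psi (G.toFun 1 (K x)) = q + L (psi (K x) - p) := by
  have hcont : Continuous fun x : 𝕊 1 ↦ psi (K x) :=
    contMDiffOn_psi.continuousOn.comp_continuous K.continuous fun x ↦ mem_psi_source (hK x)
  obtain ⟨C, hC⟩ := (isCompact_range hcont).isBounded.subset_closedBall p
  have hdet : 0 < (toMat ((ContinuousLinearEquiv.refl ℝ (𝔼 3) : 𝔼 3 ≃L[ℝ] 𝔼 3) :
      𝔼 3 →L[ℝ] 𝔼 3)).det * (toMat (L : 𝔼 3 →L[ℝ] 𝔼 3)).det := by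
    rw [ContinuousLinearEquiv.coe_refl, toMat_id, Matrix.det_one, one_mul]
    exact hL
  obtain ⟨F, hF1, R, hR⟩ := exists_ambientIsotopy_affine p q p
    (ContinuousLinearEquiv.refl ℝ (𝔼 3)) L hdet C
  set G := F.alongChart (φ := psi) contMDiffOn_psi contMDiff_psi_symm psi_target hR with hG
  refine ⟨G, fun t x ↦ ?_, fun x ↦ ?_⟩
  · rw [hG, AmbientIsotopy.alongChart_toFun, chartTransport_of_mem _ (mem_psi_source (hK x))]
    exact psi_symm_ne_southPole _
  · rw [hG, AmbientIsotopy.alongChart_toFun, chartTransport_of_mem _ (mem_psi_source (hK x)),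
      psi_apply_psi_symm]
    have h := hF1 (psi (K x)) (hC ⟨x, rfl⟩)
    simp only [ContinuousLinearEquiv.coe_refl', id_eq, add_sub_cancel] at h
    exact h

/-! ### The rotation about the vertical axis taking one horizontal unit vector to another -/

section HorizRot

variable (e₁ e₂ : 𝔼 3)

/-- The cosine-like coefficient `p = e₁₀ e₂₀ + e₁₁ e₂₁`. [folklore] -/
def rotP : ℝ := e₁ 0 * e₂ 0 + e₁ 1 * e₂ 1

/-- The sine-like coefficient `q = e₁₁ e₂₀ - e₁₀ e₂₁`. [folklore] -/
def rotQ : ℝ := e₁ 1 * e₂ 0 - e₁ 0 * e₂ 1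

/-- The matrix of the rotation about the vertical axis taking `e₂` to `e₁`. [folklore] -/
def rotMat : Matrix (Fin 3) (Fin 3) ℝ :=
  !![rotP e₁ e₂, -rotQ e₁ e₂, 0; rotQ e₁ e₂, rotP e₁ e₂, 0; 0, 0, 1]

/-- The transposed matrix (the inverse rotation). [folklore] -/
def rotMatT : Matrix (Fin 3) (Fin 3) ℝ :=
  !![rotP e₁ e₂, rotQ e₁ e₂, 0; -rotQ e₁ e₂, rotP e₁ e₂, 0; 0, 0, 1]

variable {e₁ e₂}

/-- `p² + q² = 1` for horizontal unit vectors (Lagrange's identity). [folklore] -/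
theorem rotP_sq_add_rotQ_sq (h₁ : ‖e₁‖ = 1) (h₁₂ : e₁ 2 = 0) (h₂ : ‖e₂‖ = 1) (h₂₂ : e₂ 2 = 0) :
    rotP e₁ e₂ ^ 2 + rotQ e₁ e₂ ^ 2 = 1 := by
  have n₁ : e₁ 0 ^ 2 + e₁ 1 ^ 2 = 1 := by
    have := h₁
    rw [EuclideanSpace.norm_eq, Real.sqrt_eq_one, Fin.sum_univ_three, h₁₂] at this
    simp only [Real.norm_eq_abs, sq_abs] at this
    linarith
  have n₂ : e₂ 0 ^ 2 + e₂ 1 ^ 2 = 1 := by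
    have := h₂
    rw [EuclideanSpace.norm_eq, Real.sqrt_eq_one, Fin.sum_univ_three, h₂₂] at this
    simp only [Real.norm_eq_abs, sq_abs] at this
    linarith
  simp only [rotP, rotQ]
  nlinarith [n₁, n₂]

/-- The two matrices are inverse to each other, I. [folklore] -/
theorem rotMatT_mul_rotMat (h : rotP e₁ e₂ ^ 2 + rotQ e₁ e₂ ^ 2 = 1) :
    rotMatT e₁ e₂ * rotMat e₁ e₂ = 1 := by
  ext i j
  fin_cases i <;> fin_cases j <;>
    simp [rotMat, rotMatT, Matrix.mul_apply, Fin.sum_univ_three] <;> nlinarith [h]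

/-- The two matrices are inverse to each other, II. [folklore] -/
theorem rotMat_mul_rotMatT (h : rotP e₁ e₂ ^ 2 + rotQ e₁ e₂ ^ 2 = 1) :
    rotMat e₁ e₂ * rotMatT e₁ e₂ = 1 := by
  ext i j
  fin_cases i <;> fin_cases j <;>
    simp [rotMat, rotMatT, Matrix.mul_apply, Fin.sum_univ_three] <;> nlinarith [h]

/-- The determinant of the rotation matrix is `p² + q²`. [folklore] -/
theorem det_rotMat : (rotMat e₁ e₂).det = rotP e₁ e₂ ^ 2 + rotQ e₁ e₂ ^ 2 := by
  simp [rotMat, Matrix.det_fin_three]; ring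

/-- **The rotation about the vertical axis taking `e₂` to `e₁`**, as a continuous linear
equivalence of `ℝ³` (for horizontal unit vectors). [folklore] -/
def horizRot (h : rotP e₁ e₂ ^ 2 + rotQ e₁ e₂ ^ 2 = 1) : 𝔼 3 ≃L[ℝ] 𝔼 3 :=
  ContinuousLinearEquiv.equivOfInverse (toCLM (rotMat e₁ e₂)) (toCLM (rotMatT e₁ e₂))
    (fun x ↦ by rw [← toCLM_mul_apply, rotMatT_mul_rotMat h, toCLM_one_apply])
    (fun x ↦ by rw [← toCLM_mul_apply, rotMat_mul_rotMatT h, toCLM_one_apply])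

/-- The underlying operator of `horizRot`. [folklore] -/
theorem coe_horizRot (h : rotP e₁ e₂ ^ 2 + rotQ e₁ e₂ ^ 2 = 1) :
    (horizRot h : 𝔼 3 →L[ℝ] 𝔼 3) = toCLM (rotMat e₁ e₂) := rfl

/-- `det (horizRot) = 1 > 0`. [folklore] -/
theorem det_toMat_horizRot (h : rotP e₁ e₂ ^ 2 + rotQ e₁ e₂ ^ 2 = 1) :
    (toMat (horizRot h : 𝔼 3 →L[ℝ] 𝔼 3)).det = 1 := by
  rw [coe_horizRot, toMat_toCLM, det_rotMat, h]

/-- **The rotation takes `e₂` to `e₁`.** [folklore] -/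
theorem horizRot_apply_e₂ (h₁ : ‖e₁‖ = 1) (h₁₂ : e₁ 2 = 0) (h₂ : ‖e₂‖ = 1) (h₂₂ : e₂ 2 = 0) :
    horizRot (rotP_sq_add_rotQ_sq h₁ h₁₂ h₂ h₂₂) e₂ = e₁ := by
  have n₂ : e₂ 0 ^ 2 + e₂ 1 ^ 2 = 1 := by
    have := h₂
    rw [EuclideanSpace.norm_eq, Real.sqrt_eq_one, Fin.sum_univ_three, h₂₂] at this
    simp only [Real.norm_eq_abs, sq_abs] at this
    linarith
  have happ : ∀ i, horizRot (rotP_sq_add_rotQ_sq h₁ h₁₂ h₂ h₂₂) e₂ i = ∑ j, rotMat e₁ e₂ i j * e₂ j :=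
    fun i ↦ toCLM_apply _ _ _
  ext i
  rw [happ]
  fin_cases i
  · simp [rotMat, rotP, rotQ, Fin.sum_univ_three, h₂₂]; linear_combination (e₁ 0) * n₂
  · simp [rotMat, rotP, rotQ, Fin.sum_univ_three, h₂₂]; linear_combination (e₁ 1) * n₂
  · simp [rotMat, Fin.sum_univ_three, h₂₂, h₁₂]

/-- The rotation fixes the vertical axis. [folklore] -/
theorem horizRot_apply_vertical (h : rotP e₁ e₂ ^ 2 + rotQ e₁ e₂ ^ 2 = 1) (c : ℝ) :
    horizRot h (EuclideanSpace.single 2 c) = EuclideanSpace.single 2 c := by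
  have happ : ∀ i, horizRot h (EuclideanSpace.single 2 c) i =
      ∑ j, rotMat e₁ e₂ i j * (EuclideanSpace.single (2 : Fin 3) c : 𝔼 3) j := fun i ↦ toCLM_apply _ _ _
  ext i
  rw [happ]
  fin_cases i <;> simp [rotMat]

end HorizRot

/-! ### Rotating the parameter of a knot -/

/-- The translation `θ ↦ θ + c` is a positive lift. [folklore] -/
theorem isPosLift_add_const (c : ℝ) : IsPosLift fun θ : ℝ ↦ θ + c where
  contDiff := contDiff_id.add contDiff_const
  deriv_pos θ := by
    rw [show (fun θ : ℝ ↦ θ + c) = fun θ ↦ id θ + c from rfl, deriv_add_const, deriv_id]; exact one_pos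
  add_two_pi θ := by ring

/-- **Rotating the parameter is realised by an ambient isotopy** whose orbit of the knot stays in
the knot: `G₁ (K (circlePoint θ)) = K (circlePoint (θ + c))` (the twist isotopy of the
positive lift `θ ↦ θ + c` along a tubular neighbourhood). [folklore] -/
theorem exists_ambientIsotopy_rotateParam (K : Knot) (c : ℝ) :
    ∃ G : AmbientIsotopy (𝓡 3) (𝕊 3), (∀ t x, G.toFun t (K x) ∈ range K) ∧
      ∀ θ, G.toFun 1 (K (circlePoint θ)) = K (circlePoint (θ + c)) := by
  have h := isPosLift_add_const c
  obtain ⟨ν⟩ := Knot.nonempty_tubularNbhd_holds K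
  refine ⟨twistIsotopy ν h.ambientIsotopy.toDiffeotopy, fun t x ↦ ?_, fun θ ↦ ?_⟩
  · rw [twistIsotopy_apply]; exact ⟨_, rfl⟩
  · rw [twistIsotopy_apply, AmbientIsotopy.toDiffeotopy_toFun, h.ambientIsotopy_toFun_one,
      circleDescend_circlePoint h.add_two_pi]

end Knot

end Literature.Topology.FourManifolds
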